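import Literature.Topology.FourManifolds.Gluing
import Literature.Topology.FourManifolds.SPC4Wave0Proofs
import Literature.Topology.FourManifolds.NullCobordismHomologySphere
import Literature.AlgebraicTopology.Homotopy.CollarDouble
import Literature.Barriers.SmoothPoincare4.ExoticContractibleSymmetryKillingCore
import Mathlib.Topology.Connected.LocallyPathConnected

/-!
# The double of a compact contractible 4-manifold is a homotopy 4-sphere
(registered stub `stub_doubleIsHomotopySphere` = conjunct (i) of the former stub `stub_doubleIsPresentationSphere`, line `legendrian-r-knot-rigidity`, crux
`ConvexBisection.ContractibleTwistedDoubleStandard`, item stmt-SmoothPoincare4-3546)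

Standalone, unconditional part of `work/stubs/stub_doubleIsPresentationSphere.lean` (see the
module docstring there): for a compact contractible smooth 4-manifold with boundary `W`, boundary
datum `b`, and a Hausdorff charted space `P` which is a double of `W`
(`Literature.Topology.FourManifolds.IsDouble b (𝓡 4) P`), `P ≃ₕ S⁴`.  Ingredients, all tree
THEOREMS: `IsBoundaryGluing.compactSpace`; connectedness of `∂W`
(`Literature.Barriers.SmoothPoincare4.connectedSpace_boundaryCarrier_of_contractibleSpace`,
Lefschetz duality mod 2); a collar (`NullCobordism.exists_boundaryCollar`); van Kampen and
Mayer–Vietoris for doubles (`BoundaryCollar.DoubleData.simplyConnectedSpace`,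
`DoubleData.nonempty_singularHomology_iso`, `CollarDouble.lean`); `H₁(∂W; ℤ) = 0`
(`NullCobordism.isZero_singularHomology_of_alexander` with the discharged
`isZero_localHomologyOfSet_of_contractible_nhds_holds`); and the proved recognition theorem
`nonempty_homotopyEquiv_sphere_four_iff_holds` (Freedman–Quinn 1990 §10.1).  No Stein structure,
no named fact, no `sorry`.

## References

* M. Kervaire, J. Milnor, *Groups of homotopy spheres I*, Ann. of Math. 77 (1963), Lemma 2.3.
  [KervaireMilnorAnnals1963]
* M. H. Freedman, F. Quinn, *Topology of 4-manifolds* (1990), §10.1. [FreedmanQuinnPMS1990]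
* A. Hatcher, *Algebraic Topology* (2002), Lemma 1.15, §2.2, Thm. 3.43. [HatcherAT2002]
-/

noncomputable section

-- the prescribed namespace `Summit.<P>.<Sub>.…` duplicates `SmoothPoincare4` (P = Sub)
set_option linter.dupNamespace false

open scoped Manifold ContDiff Topology ContinuousMap unitInterval
open Set Function Literature.Topology.FourManifolds
open CategoryTheory CategoryTheory.Limits
open Literature.AlgebraicTopology.SingularHomology Literature.AlgebraicTopology.Homotopy

namespace Summit.SmoothPoincare4.SmoothPoincare4.Theorems.ContractibleTwistedDoubleStandard.LegendrianRKnotRigidity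

/-! ### Conjunct (i): the double of a compact contractible 4-manifold is a homotopy 4-sphere -/

/-- **The double of a compact contractible smooth 4-manifold with boundary is a homotopy
4-sphere.**  Let `W` be a compact contractible (Hausdorff, second countable) smooth 4-manifold
with boundary, `b` a boundary datum of `W`, and `P` a Hausdorff second-countable charted space
which is a double of `W` (`IsDouble b (𝓡 4) P`: two smooth embeddings `W → P` covering `P` and
meeting exactly along `∂W`).  Then `P ≃ₕ S⁴`.  Proof: `P` is compact; `∂W` is connected
(Lefschetz duality mod 2, `connectedSpace_boundaryCarrier_of_contractibleSpace`) hence path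
connected; with a collar of `∂W` (`NullCobordism.exists_boundaryCollar`) the two copies form a
`BoundaryCollar.DoubleData`, so `P` is simply connected (van Kampen,
`DoubleData.simplyConnectedSpace`) and `H₂(P; ℤ) ≅ H₁(∂W; ℤ)` (Mayer–Vietoris,
`DoubleData.nonempty_singularHomology_iso`) `= 0` (Alexander duality, Kervaire–Milnor Lemma 2.3:
`NullCobordism.isZero_singularHomology_of_alexander` with
`isZero_localHomologyOfSet_of_contractible_nhds_holds`); conclude by the proved recognition
theorem `nonempty_homotopyEquiv_sphere_four_iff_holds` (Freedman–Quinn 1990 §10.1).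
[cite: KervaireMilnorAnnals1963, Lemma 2.3] [cite: FreedmanQuinnPMS1990, §10.1] -/
theorem nonempty_homotopyEquiv_sphere_of_isDouble
    (W : Type) [TopologicalSpace W] [T2Space W] [SecondCountableTopology W]
    [ChartedSpace (EuclideanHalfSpace 4) W] [IsManifold (𝓡∂ 4) ∞ W] [CompactSpace W]
    [ContractibleSpace W] (b : BoundaryData (𝓡∂ 4) W (𝓡 3))
    (P : Type) [TopologicalSpace P] [T2Space P] [ChartedSpace (EuclideanSpace ℝ (Fin 4)) P]
    (hD : IsDouble b (𝓡 4) P) :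
    Nonempty (P ≃ₕ Metric.sphere (0 : EuclideanSpace ℝ (Fin 5)) 1) := by
  -- `P` is compact, and second countable (Hausdorff compact manifolds are)
  haveI : CompactSpace P := hD.isBoundaryGluing.compactSpace
  haveI : SecondCountableTopology P :=
    ChartedSpace.secondCountable_of_sigmaCompact (EuclideanSpace ℝ (Fin 4)) P
  -- `∂W` is nonempty, connected, hence path connected; and compact
  haveI : ConnectedSpace b.carrier :=
    Literature.Barriers.SmoothPoincare4.connectedSpace_boundaryCarrier_of_contractibleSpace
      (n := 2) b
  haveI : LocallyPathConnectedSpace b.carrier :=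
    ChartedSpace.locallyPathConnectedSpace (EuclideanSpace ℝ (Fin 3)) b.carrier
  haveI : PathConnectedSpace b.carrier := pathConnectedSpace_iff_connectedSpace.2 inferInstance
  haveI : CompactSpace b.carrier := b.compactSpace_carrier
  -- `W` as a null-cobordism of `∂W`
  let c₀ : NullCobordism 3 b.carrier :=
    { W := W, incl := b.incl, isSmoothEmbedding_incl := b.isSmoothEmbedding,
      range_incl := b.range_incl }
  haveI : ContractibleSpace c₀.W := ‹ContractibleSpace W›
  -- a topological collar of `∂W`
  obtain ⟨κ, hκ⟩ := c₀.exists_boundaryCollar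
  -- the double data
  obtain ⟨jA, jB, hjA, hjB, hU, hR⟩ := hD
  let d : κ.DoubleData P :=
    { jA := jA, jB := jB,
      isClosedEmbedding_jA :=
        hjA.isEmbedding.continuous.isClosedEmbedding hjA.isEmbedding.injective,
      isClosedEmbedding_jB :=
        hjB.isEmbedding.continuous.isClosedEmbedding hjB.isEmbedding.injective,
      range_union_range := hU,
      jA_eq_jB_iff := fun a a' => by
        rw [hR a a']
        simp only [id_eq, hκ]
        rfl }
  have h1 : (0 : I) < 1 := zero_lt_one
  -- van Kampen: `P` is simply connected
  haveI : SimplyConnectedSpace P := d.simplyConnectedSpace h1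
  -- Mayer–Vietoris: `H₂(P; ℤ) ≅ H₁(∂W; ℤ)`
  obtain ⟨e⟩ := d.nonempty_singularHomology_iso ℤ ℤ h1 (k := 1) one_ne_zero
  -- Alexander duality: `H₁(∂W; ℤ) = 0`
  have hH₁ : IsZero (singularHomology ℤ ℤ b.carrier 1) :=
    c₀.isZero_singularHomology_of_alexander
      (isZero_localHomologyOfSet_of_contractible_nhds_holds ℤ) le_rfl one_le_two
  have hH₂ : IsZero (singularHomology ℤ ℤ P 2) := hH₁.of_iso e
  -- recognition of homotopy 4-spheres
  exact (nonempty_homotopyEquiv_sphere_four_iff_holds P).2 ⟨inferInstance, hH₂⟩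

/-- **Registered stub `stub_doubleIsHomotopySphere` of the checked skeleton (lead reshape r1) — the
double of a compact contractible smooth 4-manifold with boundary is a homotopy 4-sphere**, in the
skeleton's binder order; it is `nonempty_homotopyEquiv_sphere_of_isDouble` verbatim.
[cite: KervaireMilnorAnnals1963, Lemma 2.3] [cite: FreedmanQuinnPMS1990, §10.1] -/
theorem stub_doubleIsHomotopySphere :
    ∀ (W : Type) [TopologicalSpace W] [T2Space W] [SecondCountableTopology W]
      [ChartedSpace (EuclideanHalfSpace 4) W] [IsManifold (𝓡∂ 4) ∞ W] [CompactSpace W]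
      [ContractibleSpace W] (b : BoundaryData (𝓡∂ 4) W (𝓡 3))
      (P : Type) [TopologicalSpace P] [T2Space P] [ChartedSpace (EuclideanSpace ℝ (Fin 4)) P],
      IsDouble b (𝓡 4) P →
      Nonempty (P ≃ₕ Metric.sphere (0 : EuclideanSpace ℝ (Fin 5)) 1) :=
  fun W _ _ _ _ _ _ _ b P _ _ _ hD => nonempty_homotopyEquiv_sphere_of_isDouble W b P hD

end Summit.SmoothPoincare4.SmoothPoincare4.Theorems.ContractibleTwistedDoubleStandard.LegendrianRKnotRigidity

end
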